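import Literature.Probability.Percolation.QuadCrossingExplorationExitSetStrip
import HarnessLib

/-!
# The exit set inside the strip at an arbitrary point of the free side

Topic `Probability/Percolation`; chart-level proofs file towards the named fact
`SchrammSmirnov2011_lemma_6_1` (`QuadCrossingContinuity.lean`; O. Schramm, S. Smirnov, *On the
scaling limits of planar percolation*, Ann. Probab. 39 (2011), arXiv:1101.5820, proof of Lemma 6.1,
cases (2) and (3), p. 22–23).

`QuadCrossingExplorationExitSetStrip.lean` builds, at the landing point `x = G(b, wallTop(ω))` of
the lowest open crossing, the exit set inside the strip `[Q] ∖ [Q']` with its height bookkeeping.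
The dual exploration of case (3) (`QuadCrossingBottomCluster.lean`) lands elsewhere: at the points
`y_n = Q'(1, θ_n)` of dual crossings just above the top contact `θ_C` of the bottom open cluster.
`Charts.exists_exitSet_strip_at` is the same construction and the same fifteen conclusions at an
ARBITRARY chart point `G(b, h)` of the free side (`c ≤ h ≤ d`); the proof is that of
`Charts.exists_exitSet_strip` verbatim with `wallTop(ω)` replaced by `h` (nothing about the
configuration was used there beyond `x ∈ ∂₂Q'`).  Everything is proved.

## References

* O. Schramm, S. Smirnov, Ann. Probab. 39 (2011) 1768–1814, arXiv:1101.5820, Lemma 6.1 and its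
  proof. [SchrammSmirnov2011]
-/

noncomputable section

open Set Metric Filter Function
open _root_.Topology
open Literature.Probability.LatticeModels
open Literature.Topology.PlaneTopology

namespace Literature.Probability.Percolation

namespace SSContinuity

namespace Frame

variable (Φ : Frame) {D : Set ℂ} {Q Q' : QuadCrossing.Quad D}

variable {Φ} in
/-- **The exit set inside the strip at an arbitrary point of the free side** (see the module
docstring): `Charts.exists_exitSet_strip` with the landing point `x = G(b, wallTop)` replaced by
any chart point `G(b, h)`, `c ≤ h ≤ d`, of `∂₂Q'`. [cite: SchrammSmirnov2011, Lemma 6.1 (2)/(3) and its proof] -/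
theorem Charts.exists_exitSet_strip_at (hΦ : Φ.Charts Q') (hb : Φ.b = 1) (hc : Φ.c = -1) (hd : Φ.d = 1)
    (hG : ∀ t : unitInterval, Φ.G ⟨1, 2 * (t : ℝ) - 1⟩ = Q' (1, t)) {h : ℝ} (hh : h ∈ Icc Φ.c Φ.d)
    {ρ K : ℝ} (hρ : 0 ≤ ρ) (hK : 1 ≤ K)
    (harc : ∀ s t : unitInterval, dist (Q' (1, s)) (Q' (1, t)) ≤ ρ → ∀ u : unitInterval,
      ((s : ℝ) ≤ u ∧ (u : ℝ) ≤ t ∨ (t : ℝ) ≤ u ∧ (u : ℝ) ≤ s) → dist (Q' (1, u)) (Q' (1, s)) ≤ K * ρ)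
    (hcar : Q'.carrier ⊆ Q.carrier) (h0 : Q'.side 0 = Q.side 0) (h1 : Q'.side 1 ⊆ Q.side 1)
    (h3 : Q'.side 3 ⊆ Q.side 3) {y₂ : ℂ} (hy₂ : y₂ ∈ Q.side 2)
    (α₀ : Path (Φ.G (⟨Φ.b, h⟩ : ℂ)) y₂) (hα₀Q : range α₀ ⊆ Q.carrier)
    (hα₀x : ∀ s, dist (α₀ s) (Φ.G (⟨Φ.b, h⟩ : ℂ)) ≤ ρ) (hα₀0 : ∀ s, α₀ s ∉ Q'.side 0) :
    ∃ (E : Set ℂ) (m M : ℝ), IsCompact E ∧ IsPreconnected E ∧ E ⊆ Q.carrier ∧ Φ.G (⟨Φ.b, h⟩ : ℂ) ∈ E ∧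
      (E ∩ Q.side 2).Nonempty ∧
      (∀ e ∈ E, ∃ p : Path (Φ.G (⟨Φ.b, h⟩ : ℂ)) e, range p ⊆ Q.carrier ∧
        ∀ s, dist (p s) (Φ.G (⟨Φ.b, h⟩ : ℂ)) ≤ K * ρ) ∧
      Φ.G '' {u | u ∈ Φ.rect ∧ u.re = Φ.b ∧ u.im ∈ Icc m (h)} ⊆ E ∧
      (∀ u ∈ Φ.rect, u.re = Φ.b → Φ.G u ∈ E → m ≤ u.im) ∧ E ∩ Q'.side 0 = ∅ ∧
      E ∩ Q'.carrier ⊆ Q'.side 2 ∧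
      h ≤ M ∧ ((⟨Φ.b, M⟩ : ℂ) ∈ Φ.rect ∧ dist (Φ.G ⟨Φ.b, M⟩) (Φ.G (⟨Φ.b, h⟩ : ℂ)) ≤ ρ) ∧
      ((⟨Φ.b, m⟩ : ℂ) ∈ Φ.rect ∧ dist (Φ.G ⟨Φ.b, m⟩) (Φ.G (⟨Φ.b, h⟩ : ℂ)) ≤ ρ) ∧
      (∀ u ∈ Φ.rect, u.re = Φ.b → Φ.G u ∈ E → u.im ≤ M) ∧
      (∀ e ∈ E, e ∈ Φ.G '' {u | u ∈ Φ.rect ∧ u.re = Φ.b} ∨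
        ∃ s t : unitInterval, (s : ℝ) ≤ t ∧ α₀ t = e ∧ α₀ s ∈ Q'.side 2 ∧
          ∀ u : unitInterval, (s : ℝ) ≤ u → (u : ℝ) ≤ t → α₀ u ∈ E) := by
  have hxhrect : (⟨Φ.b, h⟩ : ℂ) ∈ Φ.rect := ⟨⟨Φ.hab.le, le_rfl⟩, hh⟩
  have hxhre : (⟨Φ.b, h⟩ : ℂ).re = Φ.b := rfl
  have hxhim : (⟨Φ.b, h⟩ : ℂ).im = h := rfl
  have hKρ : ρ ≤ K * ρ := by nlinarith
  have h0' : Q'.side 0 ⊆ Q.side 0 := h0.le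
  -- chart side points as points of `∂₂Q'`
  have hside : ∀ y : ℝ, y ∈ Icc Φ.c Φ.d → ∃ t : unitInterval, (t : ℝ) = (y + 1) / 2 ∧
      Φ.G ⟨Φ.b, y⟩ = Q' (1, t) := by
    intro y hy
    rw [hc, hd] at hy
    refine ⟨⟨(y + 1) / 2, ⟨by linarith [hy.1], by linarith [hy.2]⟩⟩, rfl, ?_⟩
    rw [← hG]
    congr 1
    apply Complex.ext <;> simp [hb]
    ring
  -- the closed strip and its trace on `[Q']`
  set clS : Set ℂ := closure (Q.carrier \ Q'.carrier) with hclS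
  have hclSQ : clS ⊆ Q.carrier := closure_minimal (fun z hz => hz.1) Q.isCompact_carrier.isClosed
  have hclS2 : clS ∩ Q'.carrier ⊆ Q'.side 2 :=
    QuadCrossing.Quad.closure_diff_inter_subset_side_two hcar h0' h1 h3
  -- the contact set and its extreme heights `m ≤ wallTop ≤ M`
  set C : Set ℂ := {u | u ∈ Φ.rect ∧ u.re = Φ.b ∧ Φ.G u ∈ range α₀} with hC
  have hCc : IsCompact C := by
    have : C = Φ.rect ∩ ({u : ℂ | u.re = Φ.b} ∩ Φ.G ⁻¹' range α₀) := by
      ext u; exact ⟨fun h => ⟨h.1, h.2.1, h.2.2⟩, fun h => ⟨h.1, h.2.1, h.2.2⟩⟩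
    rw [this]
    exact Φ.isCompact_rect.inter_right ((isClosed_eq Complex.continuous_re continuous_const).inter
      ((isCompact_range α₀.continuous).isClosed.preimage Φ.G.continuous))
  have hxhC : (⟨Φ.b, h⟩ : ℂ) ∈ C := ⟨hxhrect, hxhre, ⟨0, by rw [α₀.source]⟩⟩
  obtain ⟨um, humC, hummin⟩ := hCc.exists_isMinOn ⟨(⟨Φ.b, h⟩ : ℂ), hxhC⟩ Complex.continuous_im.continuousOn
  obtain ⟨uM, huMC, huMmax⟩ := hCc.exists_isMaxOn ⟨(⟨Φ.b, h⟩ : ℂ), hxhC⟩ Complex.continuous_im.continuousOn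
  set m : ℝ := um.im with hm
  set M : ℝ := uM.im with hM
  have hmT : m ≤ h := by rw [hm, ← hxhim]; exact hummin hxhC
  have hTM : h ≤ M := by rw [hM, ← hxhim]; exact huMmax hxhC
  have hmc : Φ.c ≤ m := humC.1.2.1
  have hMd : M ≤ Φ.d := huMC.1.2.2
  have hTd : h ≤ Φ.d := by rw [← hxhim]; exact hxhrect.2.2
  have humx : dist (Φ.G um) (Φ.G (⟨Φ.b, h⟩ : ℂ)) ≤ ρ := by
    obtain ⟨s, hs⟩ := humC.2.2
    rw [← hs]; exact hα₀x s
  have huMx : dist (Φ.G uM) (Φ.G (⟨Φ.b, h⟩ : ℂ)) ≤ ρ := by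
    obtain ⟨s, hs⟩ := huMC.2.2
    rw [← hs]; exact hα₀x s
  have hum_eq : um = ⟨Φ.b, m⟩ := Complex.ext humC.2.1 rfl
  have huM_eq : uM = ⟨Φ.b, M⟩ := Complex.ext huMC.2.1 rfl
  have hmrect : (⟨Φ.b, m⟩ : ℂ) ∈ Φ.rect := by rw [← hum_eq]; exact humC.1
  have hMrect : (⟨Φ.b, M⟩ : ℂ) ∈ Φ.rect := by rw [← huM_eq]; exact huMC.1
  have hmdist : dist (Φ.G ⟨Φ.b, m⟩) (Φ.G (⟨Φ.b, h⟩ : ℂ)) ≤ ρ := by rw [← hum_eq]; exact humx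
  have hMdist : dist (Φ.G ⟨Φ.b, M⟩) (Φ.G (⟨Φ.b, h⟩ : ℂ)) ≤ ρ := by rw [← huM_eq]; exact huMx
  -- the vertical chart segment `{re = b, im ∈ [m, M]}` and its image
  set Ah : Set ℂ := {u | u ∈ Φ.rect ∧ u.re = Φ.b ∧ u.im ∈ Icc m M} with hAh
  have hmk : Continuous fun y : ℝ => (⟨Φ.b, y⟩ : ℂ) := by
    have : (fun y : ℝ => (⟨Φ.b, y⟩ : ℂ)) = fun y : ℝ => (Φ.b : ℂ) + (y : ℂ) * Complex.I := by
      funext y; apply Complex.ext <;> simp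
    rw [this]; fun_prop
  have hmemAh : ∀ y ∈ Icc m M, (⟨Φ.b, y⟩ : ℂ) ∈ Ah := fun y hy =>
    ⟨⟨⟨Φ.hab.le, le_rfl⟩, ⟨hmc.trans hy.1, hy.2.trans hMd⟩⟩, rfl, hy⟩
  have hAh_eq : Ah = (fun y : ℝ => (⟨Φ.b, y⟩ : ℂ)) '' Icc m M := by
    refine subset_antisymm (fun u hu => ⟨u.im, hu.2.2, Complex.ext hu.2.1.symm rfl⟩) ?_
    rintro _ ⟨y, hy, rfl⟩; exact hmemAh y hy
  have hAhc : IsCompact Ah := by rw [hAh_eq]; exact isCompact_Icc.image hmk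
  have hAhpc : IsPreconnected Ah := by rw [hAh_eq]; exact isPreconnected_Icc.image _ hmk.continuousOn
  have hAhrect : Ah ⊆ Φ.rect := fun u hu => hu.1
  have hxhAh : (⟨Φ.b, h⟩ : ℂ) ∈ Ah := ⟨hxhrect, hxhre, ⟨hmT, hTM⟩⟩
  have hAhQ' : Φ.G '' Ah ⊆ Q'.side 2 := by
    rintro _ ⟨u, hu, rfl⟩
    rw [hΦ.side2]
    exact ⟨u, ⟨hu.1, hu.2.1⟩, rfl⟩
  have hAhQ : Φ.G '' Ah ⊆ Q.carrier := fun z hz => hcar (Q'.side_subset_carrier 2 (hAhQ' hz))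
  -- contacts lie on the segment
  have hCAh : ∀ u ∈ C, u ∈ Ah := fun u hu =>
    ⟨hu.1, hu.2.1, ⟨hummin hu, huMmax hu⟩⟩
  -- points of the segment are within `K ρ` of the landing point
  have harcpt : ∀ y ∈ Icc m M, dist (Φ.G ⟨Φ.b, y⟩) (Φ.G (⟨Φ.b, h⟩ : ℂ)) ≤ K * ρ := by
    intro y hy
    obtain ⟨ty, hty, hGy⟩ := hside y ⟨hmc.trans hy.1, hy.2.trans hMd⟩
    obtain ⟨tT, htT, hGT⟩ := hside (h) ⟨hmc.trans hmT, hTd⟩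
    have hxT : (Φ.G (⟨Φ.b, h⟩ : ℂ)) = Q' (1, tT) := by rw [← hGT]
    by_cases hyT : y ≤ h
    · obtain ⟨tm, htm, hGm⟩ := hside m ⟨hmc, hmT.trans hTd⟩
      have hdist : dist (Q' (1, tT)) (Q' (1, tm)) ≤ ρ := by
        rw [← hGT, ← hGm, ← hum_eq, dist_comm]; exact humx
      have := harc tT tm hdist ty
        (Or.inr ⟨by rw [htm, hty]; linarith [hy.1], by rw [hty, htT]; linarith⟩)
      rwa [← hGy, ← hxT] at this
    · push Not at hyT
      obtain ⟨tM, htMe, hGM⟩ := hside M ⟨hmc.trans (hmT.trans hTM), hMd⟩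
      have hdist : dist (Q' (1, tT)) (Q' (1, tM)) ≤ ρ := by
        rw [← hGT, ← hGM, ← huM_eq, dist_comm]; exact huMx
      have := harc tT tM hdist ty
        (Or.inl ⟨by rw [htT, hty]; linarith, by rw [hty, htMe]; linarith [hy.2]⟩)
      rwa [← hGy, ← hxT] at this
  -- the exit set
  set E : Set ℂ := (range α₀ ∩ clS) ∪ Φ.G '' Ah with hE
  have hEQ : E ⊆ Q.carrier := union_subset (inter_subset_left.trans hα₀Q) hAhQ
  -- anchors: from a point of `α₀` in the closed strip, back along `α₀` to its last visit of `[Q']`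
  have hanchor : ∀ t : unitInterval, α₀ t ∈ clS → ∃ s : ℝ, s ∈ Icc (0 : ℝ) t ∧
      α₀.extend s ∈ Q'.side 2 ∧ ∀ u ∈ Icc s (t : ℝ), α₀.extend u ∈ range α₀ ∩ clS := by
    intro t htcl
    set T : Set ℝ := {u | u ∈ Icc (0 : ℝ) t ∧ α₀.extend u ∈ Q'.carrier} with hT
    have hTc : IsClosed T :=
      (isClosed_Icc.inter (Q'.isCompact_carrier.isClosed.preimage α₀.continuous_extend))
    have h0T : (0 : ℝ) ∈ T := by
      refine ⟨⟨le_rfl, t.2.1⟩, ?_⟩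
      rw [α₀.extend_zero]
      refine Q'.side_subset_carrier 2 ?_
      rw [hΦ.side2]
      exact ⟨_, ⟨hxhrect, rfl⟩, rfl⟩
    have hTbdd : BddAbove T := ⟨t, fun u hu => hu.1.2⟩
    set s := sSup T with hs
    have hsT : s ∈ T := hTc.csSup_mem ⟨0, h0T⟩ hTbdd
    have hst : s ≤ t := hsT.1.2
    have hs0 : 0 ≤ s := hsT.1.1
    have hext : ∀ u (hu : u ∈ Icc s (t : ℝ)), α₀.extend u = α₀ ⟨u, ⟨hs0.trans hu.1, hu.2.trans t.2.2⟩⟩ :=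
      fun u hu => α₀.extend_apply ⟨hs0.trans hu.1, hu.2.trans t.2.2⟩
    -- after `s`, the path is in `[Q] ∖ [Q']`
    have hafter : ∀ u ∈ Ioc s (t : ℝ), α₀.extend u ∈ Q.carrier \ Q'.carrier := by
      intro u hu
      refine ⟨?_, fun huQ' => ?_⟩
      · rw [hext u ⟨hu.1.le, hu.2⟩]; exact hα₀Q ⟨_, rfl⟩
      · have : u ∈ T := ⟨⟨hs0.trans hu.1.le, hu.2⟩, huQ'⟩
        exact absurd (le_csSup hTbdd this) (not_le.2 hu.1)
    -- the anchor is in the closed strip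
    have hscl : α₀.extend s ∈ clS := by
      rcases hst.eq_or_lt with h | h
      · rw [h, α₀.extend_extends' t]
        exact htcl
      · have hmem : ∀ᶠ u in 𝓝[Ioc s t] s, α₀.extend u ∈ Q.carrier \ Q'.carrier :=
          eventually_nhdsWithin_of_forall fun u hu => hafter u hu
        have htend : Tendsto α₀.extend (𝓝[Ioc s t] s) (𝓝 (α₀.extend s)) :=
          (α₀.continuous_extend.tendsto s).mono_left nhdsWithin_le_nhds
        haveI : (𝓝[Ioc s (t : ℝ)] s).NeBot := by
          refine mem_closure_iff_nhdsWithin_neBot.1 ?_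
          rw [closure_Ioc h.ne]
          exact ⟨le_rfl, h.le⟩
        exact mem_closure_of_tendsto htend hmem
    have hsQ' : α₀.extend s ∈ Q'.carrier := hsT.2
    refine ⟨s, ⟨hs0, hst⟩, hclS2 ⟨hscl, hsQ'⟩, fun u hu => ?_⟩
    refine ⟨⟨_, (hext u hu).symm⟩, ?_⟩
    rcases hu.1.eq_or_lt with h | h
    · rw [← h]; exact hscl
    · exact subset_closure (hafter u ⟨h, hu.2⟩)
  -- side points of `range α₀` are contacts, hence on the segment
  have hcontact : ∀ z ∈ range α₀, z ∈ Q'.side 2 → z ∈ Φ.G '' Ah := by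
    intro z hz hz2
    rw [hΦ.side2] at hz2
    obtain ⟨u, ⟨hurect, hure⟩, rfl⟩ := hz2
    exact ⟨u, hCAh u ⟨hurect, hure, hz⟩, rfl⟩
  have hAhsub : {u | u ∈ Φ.rect ∧ u.re = Φ.b ∧ u.im ∈ Icc m (h)} ⊆ Ah := fun u hu =>
    ⟨hu.1, hu.2.1, ⟨hu.2.2.1, hu.2.2.2.trans hTM⟩⟩
  have hsub7 : Φ.G '' {u | u ∈ Φ.rect ∧ u.re = Φ.b ∧ u.im ∈ Icc m (h)} ⊆ E :=
    (image_mono hAhsub).trans subset_union_right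
  refine ⟨E, m, M, ((isCompact_range α₀.continuous).inter_right isClosed_closure).union
      (hAhc.image Φ.G.continuous), ?_, hEQ, Or.inr ⟨(⟨Φ.b, h⟩ : ℂ), hxhAh, rfl⟩, ?_, ?_, hsub7,
    ?_, ?_, ?_, hTM, ⟨hMrect, hMdist⟩, ⟨hmrect, hmdist⟩, ?_, ?_⟩
  · -- preconnected
    refine isPreconnected_of_forall (Φ.G (⟨Φ.b, h⟩ : ℂ)) fun y hy => ?_
    rcases hy with ⟨⟨t, rfl⟩, htcl⟩ | hy
    · obtain ⟨s, hsI, hs2, hseg⟩ := hanchor t htcl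
      have hsA : α₀.extend s ∈ Φ.G '' Ah := hcontact _ (hseg s ⟨le_rfl, hsI.2⟩).1 hs2
      refine ⟨Φ.G '' Ah ∪ α₀.extend '' Icc s (t : ℝ), union_subset subset_union_right ?_,
        Or.inl ⟨_, hxhAh, rfl⟩, Or.inr ⟨t, ⟨hsI.2, le_rfl⟩, α₀.extend_extends' t⟩, ?_⟩
      · rintro _ ⟨u, hu, rfl⟩
        exact Or.inl (hseg u hu)
      · exact IsPreconnected.union (α₀.extend s) hsA ⟨s, ⟨le_rfl, hsI.2⟩, rfl⟩
          (hAhpc.image _ Φ.G.continuous.continuousOn)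
          (isPreconnected_Icc.image _ α₀.continuous_extend.continuousOn)
    · exact ⟨Φ.G '' Ah, subset_union_right, ⟨_, hxhAh, rfl⟩, hy,
        hAhpc.image _ Φ.G.continuous.continuousOn⟩
  · -- `E` meets `∂₂Q`
    by_cases hyQ' : y₂ ∈ Q'.carrier
    · have hy2' : y₂ ∈ Q'.side 2 :=
        QuadCrossing.Quad.carrier_inter_side_two_subset hcar h0' h1 h3 ⟨hyQ', hy₂⟩
      exact ⟨y₂, Or.inr (hcontact y₂ ⟨1, α₀.target⟩ hy2'), hy₂⟩
    · refine ⟨y₂, Or.inl ⟨⟨1, α₀.target⟩, subset_closure ⟨?_, hyQ'⟩⟩, hy₂⟩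
      exact Q.side_subset_carrier 2 hy₂
  · -- junctions
    rintro e (⟨⟨s, rfl⟩, -⟩ | ⟨u, hu, rfl⟩)
    · refine ⟨initialPath α₀ s, (range_initialPath α₀ s).trans hα₀Q, fun t => ?_⟩
      obtain ⟨s', hs'⟩ := range_initialPath α₀ s ⟨t, rfl⟩
      rw [← hs']; exact (hα₀x s').trans hKρ
    · have huim : u.im ∈ Icc m M := hu.2.2
      have hu_eq : u = ⟨Φ.b, u.im⟩ := Complex.ext hu.2.1 rfl
      let q : Path (Φ.G (⟨Φ.b, h⟩ : ℂ)) (Φ.G u) :=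
        { toFun := fun t => Φ.G ⟨Φ.b, (h) + (t : ℝ) * (u.im - (h))⟩
          continuous_toFun := Φ.G.continuous.comp (hmk.comp (by fun_prop))
          source' := by simp
          target' := by
            conv_rhs => rw [hu_eq]
            simp }
      have hqpts : ∀ t : unitInterval,
          (h) + (t : ℝ) * (u.im - (h)) ∈ Icc m M := fun t =>
        ⟨by nlinarith [t.2.1, t.2.2, huim.1, huim.2, hmT, hTM],
          by nlinarith [t.2.1, t.2.2, huim.1, huim.2, hmT, hTM]⟩
      refine ⟨q, ?_, fun t => harcpt _ (hqpts t)⟩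
      rintro _ ⟨t, rfl⟩
      exact hAhQ ⟨_, hmemAh _ (hqpts t), rfl⟩
  · -- right-side contacts of `E` have height `≥ m`
    rintro u hurect hure (⟨huα, -⟩ | ⟨v, hv, hvu⟩)
    · exact hummin (show u ∈ C from ⟨hurect, hure, huα⟩)
    · rw [← Φ.G.injective hvu]; exact hv.2.2.1
  · -- `E` misses `∂₀Q'`
    refine eq_empty_iff_forall_notMem.2 ?_
    rintro z ⟨(⟨⟨s, rfl⟩, -⟩ | ⟨v, hv, rfl⟩), hz0⟩
    · exact hα₀0 s hz0
    · rw [hΦ.side0] at hz0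
      obtain ⟨w, ⟨-, hwre⟩, hwv⟩ := hz0
      have := Φ.G.injective hwv
      rw [this] at hwre
      linarith [Φ.hab, hv.2.1, hwre]
  · -- `E` meets `[Q']` only on `∂₂Q'`
    rintro z ⟨(⟨hzα, hzcl⟩ | hz), hzQ'⟩
    · exact hclS2 ⟨hzcl, hzQ'⟩
    · exact hAhQ' hz
  · -- right-side contacts of `E` have height `≤ M`
    rintro u hurect hure (⟨huα, -⟩ | ⟨v, hv, hvu⟩)
    · exact huMmax (show u ∈ C from ⟨hurect, hure, huα⟩)
    · rw [← Φ.G.injective hvu]; exact hv.2.2.2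
  · -- anchors
    rintro e (⟨⟨t, rfl⟩, htcl⟩ | ⟨u, hu, rfl⟩)
    · obtain ⟨s, hsI, hs2, hseg⟩ := hanchor t htcl
      right
      refine ⟨⟨s, ⟨hsI.1, hsI.2.trans t.2.2⟩⟩, t, hsI.2, rfl, ?_, fun u hsu hut => ?_⟩
      · have := α₀.extend_extends' ⟨s, ⟨hsI.1, hsI.2.trans t.2.2⟩⟩
        rw [← this]; exact hs2
      · have := (hseg u ⟨hsu, hut⟩)
        rw [α₀.extend_extends' u] at this
        exact Or.inl this
    · exact Or.inl ⟨u, ⟨hu.1, hu.2.1⟩, rfl⟩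

end Frame

end SSContinuity

end Literature.Probability.Percolation
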